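import Summits.ValiantsHypothesis.ValiantsHypothesis.Theorems.GeneratorObstructionsPerGenDegreeSuperQPJumpAtoms

/-!
# Route GeneratorObstructions — K1 `PerGenDegreeSuperQP` (stmt-ValiantsHypothesis-11654),
# line `per-side-atoms`: INTEGRALITY of jumps — at the cut with `j` lower indices every
# occurring jump is a multiple of `n / gcd(n, j)`

Companion of `…JumpAtoms` (first fattening of the minimal jump is an atom).

For ANY polynomial `f` in the `m² = |MatIdx m|` lexicographic matrix variables and any degree
`n ≠ 0`: an occurring two-block weight `-(t·𝟙 + k·𝟙_{a > p})` of `ℂ[Δ_n[f]]` at the cut `p` has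
size `-(t·m² + k·(m² - j))`, `j = #{a ≤ p}`, and the size of an occurring weight is `-n·(degree)`
(`nonpos_and_exists_size_eq_of_hasHighestWeight_orbitCoordRep`). For the permanent (`n = m`)
this forces `m ∣ k·j`:

1. `size_eq_of_jump` — the size of a two-block weight of jump `k` at `p` is
   `|MatIdx m| · χ(b₀) + k · #{a ≤ p}` for any upper index `b₀`.
2. `per_dvd_jump_mul_card` — for an occurring two-block weight of `ℂ[Δ_m[per_m]]` of jump `k` at
   `p`: `(m : ℤ) ∣ k · #{a ≤ p}`.
3. `per_div_gcd_dvd_jump`, `per_le_jump` — hence `m / gcd(m, j) ∣ k`, and a POSITIVE jump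
   satisfies `k ≥ m / gcd(m, j)`; at cuts with `gcd(m, j) = 1` every positive jump is a multiple
   of `m` (`≥ m`). This is the fattened (`t ≥ 0`) companion of
   `…ChowRayAtom.le_of_per_rectangle_occurs` (`k ≥ m` on the pure rays, from plethysm), and the
   lower half of the bracket `m / gcd(m,j) ≤ k_min(p) ≤ 2m²` for the minimal jump whose upper
   half is the orbit-restriction bound of this session's memo (not in Lean).

Honest framing: bookkeeping for the two-block faces; `stub_atomLate` (for `c ≥ 2`), K1 and
`GenFlipThesis` remain OPEN; nothing here bears on VP versus VNP. [folklore]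
-/

set_option linter.dupNamespace false

noncomputable section

namespace Summit.ValiantsHypothesis.ValiantsHypothesis.Theorems.GeneratorObstructions.PerGenDegreeSuperQP

open MvPolynomial
open Literature.NumberTheory.DiophantineGeometry Literature.Computability.AlgebraicComplexity
  Literature.Computability.Complexity

/-! ### 1. The size of a two-block weight -/

section Size

variable {σ : Type*} [Fintype σ] [LinearOrder σ]

/-- **Size of a two-block weight.** If `χ` is constant on `{a > p}` and has jump `k` at `p`,
then for any index `b₀ > p`: `|χ| = |σ| · χ b₀ + k · #{a ≤ p}`. [folklore] -/
theorem size_eq_of_jump (p : σ) {k : ℤ} {χ : Weight σ}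
    (h2 : ∀ a b : σ, (a ≤ p ↔ b ≤ p) → χ a = χ b)
    (hk : ∀ a b : σ, a ≤ p → ¬ b ≤ p → χ a = χ b + k) {b₀ : σ} (hb₀ : ¬ b₀ ≤ p) :
    χ.size = (Fintype.card σ : ℤ) * χ b₀ + k * ((Finset.univ.filter fun a : σ => a ≤ p).card : ℤ) := by
  classical
  have hχ : ∀ a : σ, χ a = χ b₀ + (if a ≤ p then k else 0) := by
    intro a
    by_cases ha : a ≤ p
    · rw [if_pos ha, hk a b₀ ha hb₀]
    · rw [if_neg ha, add_zero, h2 a b₀ (iff_of_false ha hb₀)]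
  unfold Weight.size
  rw [Finset.sum_congr rfl fun a _ => hχ a, Finset.sum_add_distrib, Finset.sum_const,
    Finset.card_univ, Finset.sum_ite, Finset.sum_const, Finset.sum_const_zero, add_zero]
  simp only [nsmul_eq_mul]
  ring

end Size

/-! ### 2. The permanent: `m ∣ k · j` -/

variable {m : ℕ}

/-- **Integrality of jumps for the permanent.** An occurring two-block weight of `ℂ[Δ_m[per_m]]`
with jump `k` at the cut `p` satisfies `m ∣ k · #{a ≤ p}`, provided the upper block `{a > p}` is
nonempty (otherwise the jump is not determined): its size `m²·χ(b₀) + k·j` is `-m·D` for the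
degree `D`. [folklore] -/
theorem per_dvd_jump_mul_card (p : MatIdx m) {k : ℤ} {χ : Weight (MatIdx m)}
    (hχ : highestWeightSpace (orbitCoordRep (MvPolynomial.rename toLex (perPoly (Fin m) ℂ)) m) χ ≠ ⊥)
    (h2 : ∀ a b : MatIdx m, (a ≤ p ↔ b ≤ p) → χ a = χ b)
    (hk : ∀ a b : MatIdx m, a ≤ p → ¬ b ≤ p → χ a = χ b + k)
    (hhi : ∃ b₀ : MatIdx m, ¬ b₀ ≤ p) :
    (m : ℤ) ∣ k * ((Finset.univ.filter fun a : MatIdx m => a ≤ p).card : ℤ) := by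
  classical
  haveI : Infinite ℂ := CharZero.infinite ℂ
  obtain ⟨b₀, hb₀⟩ := hhi
  obtain ⟨-, D, hD⟩ := nonpos_and_exists_size_eq_of_hasHighestWeight_orbitCoordRep
    (rename toLex (perPoly (Fin m) ℂ))
    (show HasHighestWeight (orbitCoordRep (rename toLex (perPoly (Fin m) ℂ)) m) χ from hχ)
  have hsize := size_eq_of_jump p h2 hk hb₀
  rw [Fintype.card_lex, Fintype.card_prod, Fintype.card_fin] at hsize
  have hkey : k * ((Finset.univ.filter fun a : MatIdx m => a ≤ p).card : ℤ) =
      -((m * D : ℕ) : ℤ) - ((m * m : ℕ) : ℤ) * χ b₀ := by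
    rw [← hD, hsize]; ring
  rw [hkey]
  push_cast
  exact ⟨-(D : ℤ) - (m : ℤ) * χ b₀, by ring⟩

/-- **`m / gcd(m, j)` divides every occurring jump** at a cut with `j = #{a ≤ p}` lower indices
and a nonempty upper block (from `m ∣ k·j` and coprimality of `m / gcd` and `j / gcd`).
[folklore] -/
theorem per_div_gcd_dvd_jump (p : MatIdx m) {k : ℤ} {χ : Weight (MatIdx m)}
    (hχ : highestWeightSpace (orbitCoordRep (MvPolynomial.rename toLex (perPoly (Fin m) ℂ)) m) χ ≠ ⊥)
    (h2 : ∀ a b : MatIdx m, (a ≤ p ↔ b ≤ p) → χ a = χ b)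
    (hk : ∀ a b : MatIdx m, a ≤ p → ¬ b ≤ p → χ a = χ b + k)
    (hhi : ∃ b₀ : MatIdx m, ¬ b₀ ≤ p) :
    ((m / Nat.gcd m (Finset.univ.filter fun a : MatIdx m => a ≤ p).card : ℕ) : ℤ) ∣ k := by
  classical
  -- `m = 0` is impossible: `MatIdx 0` is empty but `p` inhabits it
  rcases Nat.eq_zero_or_pos m with hm | hm
  · subst hm
    exact ((ofLex p).1).elim0
  set j := (Finset.univ.filter fun a : MatIdx m => a ≤ p).card with hj
  have hdvd : (m : ℤ) ∣ k * (j : ℤ) := per_dvd_jump_mul_card p hχ h2 hk hhi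
  set g := Nat.gcd m j with hg
  have hgpos : 0 < g := Nat.gcd_pos_of_pos_left j hm
  have hm1 : (m : ℤ) = (g : ℤ) * ((m / g : ℕ) : ℤ) := by
    exact_mod_cast (Nat.mul_div_cancel' (Nat.gcd_dvd_left m j)).symm
  have hj1 : (j : ℤ) = (g : ℤ) * ((j / g : ℕ) : ℤ) := by
    exact_mod_cast (Nat.mul_div_cancel' (Nat.gcd_dvd_right m j)).symm
  have hcop : IsCoprime ((m / g : ℕ) : ℤ) ((j / g : ℕ) : ℤ) :=
    Nat.isCoprime_iff_coprime.mpr (Nat.coprime_div_gcd_div_gcd hgpos)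
  rw [hm1, hj1] at hdvd
  have h1 : (g : ℤ) * ((m / g : ℕ) : ℤ) ∣ (g : ℤ) * (k * ((j / g : ℕ) : ℤ)) := by
    have e : k * ((g : ℤ) * ((j / g : ℕ) : ℤ)) = (g : ℤ) * (k * ((j / g : ℕ) : ℤ)) := by ring
    rw [← e]; exact hdvd
  have hg0 : (g : ℤ) ≠ 0 := by exact_mod_cast hgpos.ne'
  exact hcop.dvd_of_dvd_mul_right ((mul_dvd_mul_iff_left hg0).mp h1)

/-- **Lower bound for positive jumps.** An occurring two-block weight of `ℂ[Δ_m[per_m]]` with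
POSITIVE jump `k` at the cut `p` has `k ≥ m / gcd(m, #{a ≤ p})`; at cuts with
`gcd(m, #{a ≤ p}) = 1` every positive jump is at least `m`. In particular the minimal jump of
`…JumpAtoms.exists_atom_minJump` at `p` is at least `m / gcd(m, #{a ≤ p})`. (If the upper block
is empty then `#{a ≤ p} = m²`, the bound reads `1 ≤ k`.) [folklore] -/
theorem per_le_jump (p : MatIdx m) {k : ℤ} {χ : Weight (MatIdx m)}
    (hχ : highestWeightSpace (orbitCoordRep (MvPolynomial.rename toLex (perPoly (Fin m) ℂ)) m) χ ≠ ⊥)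
    (h2 : ∀ a b : MatIdx m, (a ≤ p ↔ b ≤ p) → χ a = χ b)
    (hk : ∀ a b : MatIdx m, a ≤ p → ¬ b ≤ p → χ a = χ b + k) (hpos : 0 < k) :
    ((m / Nat.gcd m (Finset.univ.filter fun a : MatIdx m => a ≤ p).card : ℕ) : ℤ) ≤ k := by
  classical
  by_cases hhi : ∃ b₀ : MatIdx m, ¬ b₀ ≤ p
  · exact Int.le_of_dvd hpos (per_div_gcd_dvd_jump p hχ h2 hk hhi)
  · push Not at hhi
    have hfilter : (Finset.univ.filter fun a : MatIdx m => a ≤ p) = Finset.univ :=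
      Finset.filter_true_of_mem fun a _ => hhi a
    rw [hfilter, Finset.card_univ, Fintype.card_lex, Fintype.card_prod, Fintype.card_fin,
      Nat.gcd_eq_left (dvd_mul_right m m)]
    have h1 : m / m ≤ 1 := Nat.div_le_of_le_mul (by omega)
    have h2' : ((m / m : ℕ) : ℤ) ≤ 1 := by exact_mod_cast h1
    omega

end Summit.ValiantsHypothesis.ValiantsHypothesis.Theorems.GeneratorObstructions.PerGenDegreeSuperQP

end
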